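import Mathlib
import HarnessLib
import Summits.SmoothPoincare4.SmoothPoincare4.Theorems.ConvexBisectionAcyclicBisectionRigidityStubMatsumotoNormalFormAux2
import Summits.SmoothPoincare4.SmoothPoincare4.Theorems.ConvexBisectionAcyclicBisectionRigidityStubMatsumotoNormalFormAux3

/-!
# Matsumoto's normal form for four-letter genus-one words, IV: the move table, mixed classes

Helper file for stub D-alg (`stub_matsumotoNormalForm`), line `folded-curve-branch-locus`, crux
`ConvexBisection.AcyclicBisectionRigidity` (item stmt-SmoothPoincare4-10507).  Pure integer
arithmetic, continuing part III: the mixed sign classes `(s, −s, −s, s)` (`Matsumoto.class_mixβ`)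
and `(s, s, −s, −s)` (`Matsumoto.class_mixγ`), both reduced to `Matsumoto.core_mix` of part II,
the classification of the six sign patterns with two letters of each sign
(`Matsumoto.sign_classes`), and the assembled ARITHMETIC DESCENT LEMMA `helper_arith_moves`: the
seven polynomial identities `PL, A11, A12, A21, D12, D21, D22` implied by trivial monodromy
(part I, `helper_fund_identity`, applied to the word and to its rotation) force, unless the word is
terminal (a cyclically adjacent opposite pair with vanishing pairing), one of the six signed
Hurwitz moves to strictly decrease `|a| + ⋯ + |f|`.

Reference: Y. Matsumoto, J. Math. Soc. Japan 37 (1985), Thm. 3.2.  Everything is proved.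
-/

set_option linter.dupNamespace false

namespace Summit.SmoothPoincare4.SmoothPoincare4.Theorems.AcyclicBisectionRigidity.FoldedCurveBranchLocus

namespace Matsumoto

/-- **Mixed class** `(s, −s, −s, s)`: some move decreases the complexity. [folklore] -/
theorem class_mixβ (s₁ a b c d e f : ℤ) (hs₁ : s₁ = 1 ∨ s₁ = -1)
    (ha : a ≠ 0)
    (hPL : a * f - b * e + c * d = 0)
    (hA11 : -(-s₁) * a ^ 2 = (-s₁) * b ^ 2 + s₁ * c ^ 2 + (-s₁) * s₁ * f * b * c)
    (hA12 : 0 = (-s₁) * b * d + s₁ * c * e + (-s₁) * s₁ * f * c * d)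
    (hT1 : a * (s₁ * (-s₁) * a ^ 2 - (-s₁) * s₁ * f ^ 2) = 0)
    (hT2 : c * (s₁ * s₁ * c ^ 2 - (-s₁) * (-s₁) * d ^ 2) = 0) :
    SomeMoveDecreases a b c d e f s₁ (-s₁) (-s₁) s₁ := by
  have hs2 : s₁ * s₁ = 1 := by rcases hs₁ with rfl | rfl <;> norm_num
  have hs0 : s₁ ≠ 0 := by rcases hs₁ with rfl | rfl <;> norm_num
  have hs₁' : -s₁ = 1 ∨ -s₁ = -1 := by rcases hs₁ with rfl | rfl <;> norm_num
  have hc : c ≠ 0 := by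
    rintro rfl
    have h1 : s₁ * (a ^ 2 + b ^ 2) = 0 := by linear_combination hA11
    have h2 : a ^ 2 + b ^ 2 = 0 := (mul_eq_zero.mp h1).resolve_left hs0
    have h3 : a ^ 2 = 0 := by nlinarith [sq_nonneg a, sq_nonneg b]
    exact ha (pow_eq_zero_iff two_ne_zero |>.mp h3)
  have hfa : f ^ 2 = a ^ 2 := by
    have h1 : a * (f ^ 2 - a ^ 2) = 0 := by linear_combination hT1 + (-(a * (f ^ 2 - a ^ 2))) * hs2
    exact sub_eq_zero.mp ((mul_eq_zero.mp h1).resolve_left ha)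
  have hdc : d ^ 2 = c ^ 2 := by
    have h1 : c * (d ^ 2 - c ^ 2) = 0 := by linear_combination -hT2 + (-(c * (d ^ 2 - c ^ 2))) * hs2
    exact sub_eq_zero.mp ((mul_eq_zero.mp h1).resolve_left hc)
  unfold SomeMoveDecreases
  rcases sq_eq_sq_iff_eq_or_eq_neg.mp hdc with hd | hd <;>
    rcases sq_eq_sq_iff_eq_or_eq_neg.mp hfa with hf | hf
  · -- ρ = 1, θ = 1 : contradiction
    exfalso
    rw [eq_comm] at hd hf
    subst hd hf
    have hL : c * (-(a * c * s₁ ^ 2) + -(b * s₁) + e * s₁) = 0 :=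
        by linear_combination (-1 : ℤ) * hA12
    have hL' := (mul_eq_zero.mp hL).resolve_left hc
    have he : e = a * c * s₁ + b := by linear_combination s₁ * hL' + (a * c * s₁ + -e + b) * hs2
    subst he
    have h2 : 2 * a ^ 2 * s₁ = 0 := by linear_combination hA11 + s₁ * hPL
    have : a ^ 2 = 0 := by
      rcases mul_eq_zero.mp h2 with h | h
      · simpa using h
      · exact absurd h hs0
    exact ha (pow_eq_zero_iff two_ne_zero |>.mp this)
  · -- ρ = 1, θ = -1 : valid, t = -s₁
    rw [eq_comm] at hd
    subst hd hf
    have hL : c * (a * c * s₁ ^ 2 + -(b * s₁) + e * s₁) = 0 := by linear_combination (-1 : ℤ) * hA12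
    have hL' := (mul_eq_zero.mp hL).resolve_left hc
    have he : e = -(a * c * s₁) + b :=
        by linear_combination s₁ * hL' + (-(a * c * s₁) + -e + b) * hs2
    subst he
    have hcons : b * (b + (-s₁) * a * c) = c ^ 2 - a ^ 2 := by
      linear_combination s₁ * hA11 + (-(a ^ 2) + a * b * c * s₁ + -(b ^ 2) + c ^ 2) * hs2
    have hcore := core_mix a c b (-s₁) hs₁' ha hc hcons
    rcases hcore with hi | hi | hi | hi
    · refine Or.inl ?_
      rcases hs₁ with rfl | rfl <;> convert hi using 2 <;>
        exact (sq_eq_sq_iff_abs_eq_abs _ _).mp (by ring)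
    · refine Or.inr (Or.inr (Or.inr (Or.inl ?_)))
      rcases hs₁ with rfl | rfl <;> convert hi using 2 <;>
        exact (sq_eq_sq_iff_abs_eq_abs _ _).mp (by ring)
    · refine Or.inr (Or.inl ?_)
      rcases hs₁ with rfl | rfl <;> convert hi using 2 <;>
        exact (sq_eq_sq_iff_abs_eq_abs _ _).mp (by ring)
    · refine Or.inr (Or.inr (Or.inl ?_))
      rcases hs₁ with rfl | rfl <;> convert hi using 2 <;>
        exact (sq_eq_sq_iff_abs_eq_abs _ _).mp (by ring)
  · -- ρ = -1, θ = 1 : valid, t = s₁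
    rw [eq_comm] at hf
    subst hd hf
    have hL : c * (a * c * s₁ ^ 2 + b * s₁ + e * s₁) = 0 := by linear_combination (-1 : ℤ) * hA12
    have hL' := (mul_eq_zero.mp hL).resolve_left hc
    have he : e = -(a * c * s₁) + -b :=
        by linear_combination s₁ * hL' + (-(a * c * s₁) + -e + -b) * hs2
    subst he
    have hcons : b * (b + s₁ * a * c) = c ^ 2 - a ^ 2 := by
      linear_combination s₁ * hA11 + (-(a ^ 2) + -(a * b * c * s₁) + -(b ^ 2) + c ^ 2) * hs2
    have hcore := core_mix a c b s₁ hs₁ ha hc hcons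
    rcases hcore with hi | hi | hi | hi
    · refine Or.inl ?_
      rcases hs₁ with rfl | rfl <;> convert hi using 2 <;>
        exact (sq_eq_sq_iff_abs_eq_abs _ _).mp (by ring)
    · refine Or.inr (Or.inr (Or.inr (Or.inl ?_)))
      rcases hs₁ with rfl | rfl <;> convert hi using 2 <;>
        exact (sq_eq_sq_iff_abs_eq_abs _ _).mp (by ring)
    · refine Or.inr (Or.inl ?_)
      rcases hs₁ with rfl | rfl <;> convert hi using 2 <;>
        exact (sq_eq_sq_iff_abs_eq_abs _ _).mp (by ring)
    · refine Or.inr (Or.inr (Or.inl ?_))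
      rcases hs₁ with rfl | rfl <;> convert hi using 2 <;>
        exact (sq_eq_sq_iff_abs_eq_abs _ _).mp (by ring)
  · -- ρ = -1, θ = -1 : contradiction
    exfalso
    subst hd hf
    have hL : c * (-(a * c * s₁ ^ 2) + b * s₁ + e * s₁) = 0 := by linear_combination (-1 : ℤ) * hA12
    have hL' := (mul_eq_zero.mp hL).resolve_left hc
    have he : e = a * c * s₁ + -b := by linear_combination s₁ * hL' + (a * c * s₁ + -e + -b) * hs2
    subst he
    have h2 : 2 * a ^ 2 * s₁ = 0 := by linear_combination hA11 - s₁ * hPL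
    have : a ^ 2 = 0 := by
      rcases mul_eq_zero.mp h2 with h | h
      · simpa using h
      · exact absurd h hs0
    exact ha (pow_eq_zero_iff two_ne_zero |>.mp this)

/-- **Mixed class** `(s, s, −s, −s)`: some move decreases the complexity. [folklore] -/
theorem class_mixγ (s₁ a b c d e f : ℤ) (hs₁ : s₁ = 1 ∨ s₁ = -1)
    (hc : c ≠ 0)
    (hPL : a * f - b * e + c * d = 0)
    (hA11 : -s₁ * a ^ 2 = (-s₁) * b ^ 2 + (-s₁) * c ^ 2 + (-s₁) * (-s₁) * f * b * c)
    (hA12 : 0 = (-s₁) * b * d + (-s₁) * c * e + (-s₁) * (-s₁) * f * c * d)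
    (hD22 : -(-s₁) * c ^ 2 = s₁ * a ^ 2 + (-s₁) * b ^ 2 + s₁ * (-s₁) * d * a * b)
    (hT1 : a * (s₁ * s₁ * a ^ 2 - (-s₁) * (-s₁) * f ^ 2) = 0)
    (hT2 : c * (s₁ * (-s₁) * c ^ 2 - s₁ * (-s₁) * d ^ 2) = 0) :
    SomeMoveDecreases a b c d e f s₁ s₁ (-s₁) (-s₁) := by
  have hs2 : s₁ * s₁ = 1 := by rcases hs₁ with rfl | rfl <;> norm_num
  have hs0 : s₁ ≠ 0 := by rcases hs₁ with rfl | rfl <;> norm_num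
  have hs₁' : -s₁ = 1 ∨ -s₁ = -1 := by rcases hs₁ with rfl | rfl <;> norm_num
  have ha : a ≠ 0 := by
    rintro rfl
    have h1 : s₁ * (c ^ 2 + b ^ 2) = 0 := by linear_combination hD22
    have h2 : c ^ 2 + b ^ 2 = 0 := (mul_eq_zero.mp h1).resolve_left hs0
    have h3 : c ^ 2 = 0 := by nlinarith [sq_nonneg c, sq_nonneg b]
    exact hc (pow_eq_zero_iff two_ne_zero |>.mp h3)
  have hfa : f ^ 2 = a ^ 2 := by
    have h1 : a * (f ^ 2 - a ^ 2) = 0 := by linear_combination -hT1 + (-(a * (f ^ 2 - a ^ 2))) * hs2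
    exact sub_eq_zero.mp ((mul_eq_zero.mp h1).resolve_left ha)
  have hdc : d ^ 2 = c ^ 2 := by
    have h1 : c * (d ^ 2 - c ^ 2) = 0 := by linear_combination hT2 + (-(c * (d ^ 2 - c ^ 2))) * hs2
    exact sub_eq_zero.mp ((mul_eq_zero.mp h1).resolve_left hc)
  unfold SomeMoveDecreases
  rcases sq_eq_sq_iff_eq_or_eq_neg.mp hdc with hd | hd <;>
    rcases sq_eq_sq_iff_eq_or_eq_neg.mp hfa with hf | hf
  · -- ρ = 1, θ = 1 : contradiction
    exfalso
    rw [eq_comm] at hd hf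
    subst hd hf
    have hL : c * (a * c * s₁ ^ 2 + -(b * s₁) + -(e * s₁)) = 0 :=
        by linear_combination (-1 : ℤ) * hA12
    have hL' := (mul_eq_zero.mp hL).resolve_left hc
    have he : e = a * c * s₁ + -b :=
        by linear_combination (-s₁) * hL' + (a * c * s₁ + -e + -b) * hs2
    subst he
    have h2 : 2 * a ^ 2 * s₁ = 0 := by linear_combination -hA11 + s₁ * hPL
    have : a ^ 2 = 0 := by
      rcases mul_eq_zero.mp h2 with h | h
      · simpa using h
      · exact absurd h hs0
    exact ha (pow_eq_zero_iff two_ne_zero |>.mp this)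
  · -- ρ = 1, θ = -1 : valid, t_γ = -s₁
    rw [eq_comm] at hd
    subst hd hf
    have hL : c * (-(a * c * s₁ ^ 2) + -(b * s₁) + -(e * s₁)) = 0 :=
        by linear_combination (-1 : ℤ) * hA12
    have hL' := (mul_eq_zero.mp hL).resolve_left hc
    have he : e = -(a * c * s₁) + -b :=
        by linear_combination (-s₁) * hL' + (-(a * c * s₁) + -e + -b) * hs2
    subst he
    have hcons : b * (b + s₁ * c * a) = a ^ 2 - c ^ 2 := by
      linear_combination s₁ * hA11 + (a ^ 2 + -(a * b * c * s₁) + -(b ^ 2) + -(c ^ 2)) * hs2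
    have hcore := core_mix c a b s₁ hs₁ hc ha hcons
    rcases hcore with hi | hi | hi | hi
    · refine Or.inr (Or.inr (Or.inr (Or.inl ?_)))
      rcases hs₁ with rfl | rfl <;> convert hi using 2 <;>
        exact (sq_eq_sq_iff_abs_eq_abs _ _).mp (by ring)
    · refine Or.inl ?_
      rcases hs₁ with rfl | rfl <;> convert hi using 2 <;>
        exact (sq_eq_sq_iff_abs_eq_abs _ _).mp (by ring)
    · refine Or.inr (Or.inr (Or.inl ?_))
      rcases hs₁ with rfl | rfl <;> convert hi using 2 <;>
        exact (sq_eq_sq_iff_abs_eq_abs _ _).mp (by ring)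
    · refine Or.inr (Or.inl ?_)
      rcases hs₁ with rfl | rfl <;> convert hi using 2 <;>
        exact (sq_eq_sq_iff_abs_eq_abs _ _).mp (by ring)
  · -- ρ = -1, θ = 1 : valid, t_γ = s₁
    rw [eq_comm] at hf
    subst hd hf
    have hL : c * (-(a * c * s₁ ^ 2) + b * s₁ + -(e * s₁)) = 0 :=
        by linear_combination (-1 : ℤ) * hA12
    have hL' := (mul_eq_zero.mp hL).resolve_left hc
    have he : e = -(a * c * s₁) + b :=
        by linear_combination (-s₁) * hL' + (-(a * c * s₁) + -e + b) * hs2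
    subst he
    have hcons : b * (b + (-s₁) * c * a) = a ^ 2 - c ^ 2 := by
      linear_combination s₁ * hA11 + (a ^ 2 + a * b * c * s₁ + -(b ^ 2) + -(c ^ 2)) * hs2
    have hcore := core_mix c a b (-s₁) hs₁' hc ha hcons
    rcases hcore with hi | hi | hi | hi
    · refine Or.inr (Or.inr (Or.inr (Or.inl ?_)))
      rcases hs₁ with rfl | rfl <;> convert hi using 2 <;>
        exact (sq_eq_sq_iff_abs_eq_abs _ _).mp (by ring)
    · refine Or.inl ?_
      rcases hs₁ with rfl | rfl <;> convert hi using 2 <;>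
        exact (sq_eq_sq_iff_abs_eq_abs _ _).mp (by ring)
    · refine Or.inr (Or.inr (Or.inl ?_))
      rcases hs₁ with rfl | rfl <;> convert hi using 2 <;>
        exact (sq_eq_sq_iff_abs_eq_abs _ _).mp (by ring)
    · refine Or.inr (Or.inl ?_)
      rcases hs₁ with rfl | rfl <;> convert hi using 2 <;>
        exact (sq_eq_sq_iff_abs_eq_abs _ _).mp (by ring)
  · -- ρ = -1, θ = -1 : contradiction
    exfalso
    subst hd hf
    have hL : c * (a * c * s₁ ^ 2 + b * s₁ + -(e * s₁)) = 0 := by linear_combination (-1 : ℤ) * hA12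
    have hL' := (mul_eq_zero.mp hL).resolve_left hc
    have he : e = a * c * s₁ + b := by linear_combination (-s₁) * hL' + (a * c * s₁ + -e + b) * hs2
    subst he
    have h2 : 2 * a ^ 2 * s₁ = 0 := by linear_combination -hA11 - s₁ * hPL
    have : a ^ 2 = 0 := by
      rcases mul_eq_zero.mp h2 with h | h
      · simpa using h
      · exact absurd h hs0
    exact ha (pow_eq_zero_iff two_ne_zero |>.mp this)


/-- The six sign patterns with two letters of each sign fall into three classes. [folklore] -/
theorem sign_classes (s₁ s₂ s₃ s₄ : ℤ) (h₁ : s₁ = 1 ∨ s₁ = -1) (h₂ : s₂ = 1 ∨ s₂ = -1)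
    (h₃ : s₃ = 1 ∨ s₃ = -1) (h₄ : s₄ = 1 ∨ s₄ = -1) (h22 : s₁ + s₂ + s₃ + s₄ = 0) :
    (s₂ = -s₁ ∧ s₃ = s₁ ∧ s₄ = -s₁) ∨ (s₂ = -s₁ ∧ s₃ = -s₁ ∧ s₄ = s₁) ∨
      (s₂ = s₁ ∧ s₃ = -s₁ ∧ s₄ = -s₁) := by
  rcases h₁ with rfl | rfl <;> rcases h₂ with rfl | rfl <;> rcases h₃ with rfl | rfl <;>
    rcases h₄ with rfl | rfl <;> omega

end Matsumoto

/-- **The arithmetic descent lemma.**  For the six pairings `a … f` and the signs `s₁ … s₄` of a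
four-letter genus-one word with two letters of each sign and trivial monodromy (encoded by the seven
polynomial identities `PL, A11, A12, A21, D12, D21, D22`), which is not terminal (no cyclically adjacent
opposite pair with vanishing pairing), one of the six signed Hurwitz moves strictly decreases
`|a| + |b| + |c| + |d| + |e| + |f|`. [folklore] -/
theorem helper_arith_moves (a b c d e f s₁ s₂ s₃ s₄ : ℤ)
    (hs₁ : s₁ = 1 ∨ s₁ = -1) (hs₂ : s₂ = 1 ∨ s₂ = -1) (hs₃ : s₃ = 1 ∨ s₃ = -1)
    (hs₄ : s₄ = 1 ∨ s₄ = -1) (h22 : s₁ + s₂ + s₃ + s₄ = 0)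
    (hPL : a * f - b * e + c * d = 0)
    (hA11 : -s₂ * a ^ 2 = s₃ * b ^ 2 + s₄ * c ^ 2 + s₃ * s₄ * f * b * c)
    (hA12 : 0 = s₃ * b * d + s₄ * c * e + s₃ * s₄ * f * c * d)
    (hA21 : s₁ * s₂ * a ^ 3 = s₃ * b * d + s₄ * c * e + s₃ * s₄ * f * b * e)
    (hD12 : 0 = -s₂ * a * e - s₃ * b * f - s₂ * s₃ * a * d * f)
    (hD21 : -s₁ * s₄ * c ^ 3 = -s₂ * a * e - s₃ * b * f - s₂ * s₃ * b * d * e)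
    (hD22 : -s₄ * c ^ 2 = s₂ * a ^ 2 + s₃ * b ^ 2 + s₂ * s₃ * d * a * b)
    (hna : s₁ ≠ s₂ → a ≠ 0) (hnd : s₂ ≠ s₃ → d ≠ 0) (hnc : s₁ ≠ s₄ → c ≠ 0) :
    |d + s₁ * a * b| + |e + s₁ * a * c| < |d| + |e| ∨
    |c + s₂ * a * e| + |b + s₂ * a * d| < |b| + |c| ∨
    |f + s₂ * d * e| + |b + s₂ * d * a| < |b| + |f| ∨
    |a + s₃ * d * b| + |e + s₃ * d * f| < |a| + |e| ∨
    |c + s₃ * f * b| + |e + s₃ * f * d| < |c| + |e| ∨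
    |d + s₄ * f * e| + |b + s₄ * f * c| < |b| + |d| := by
  show Matsumoto.SomeMoveDecreases a b c d e f s₁ s₂ s₃ s₄
  have hT1 : a * (s₁ * s₂ * a ^ 2 - s₃ * s₄ * f ^ 2) = 0 := by
    linear_combination hA21 - hA12 - s₃ * s₄ * f * hPL
  have hT2 : c * (s₁ * s₄ * c ^ 2 - s₂ * s₃ * d ^ 2) = 0 := by
    linear_combination hD12 - hD21 - s₂ * s₃ * d * hPL
  have hne : s₁ ≠ -s₁ := by rcases hs₁ with rfl | rfl <;> norm_num
  rcases Matsumoto.sign_classes s₁ s₂ s₃ s₄ hs₁ hs₂ hs₃ hs₄ h22 with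
    ⟨h2, h3, h4⟩ | ⟨h2, h3, h4⟩ | ⟨h2, h3, h4⟩
  · subst h2 h4
    rw [eq_comm] at h3
    subst h3
    exact helper_class_alt s₁ a b c d e f hs₁ (hna hne) (hnc hne) hPL hA11 hA12 hT1 hT2
  · subst h2 h3
    rw [eq_comm] at h4
    subst h4
    exact Matsumoto.class_mixβ s₁ a b c d e f hs₁ (hna hne) hPL hA11 hA12 hT1 hT2
  · subst h3 h4
    rw [eq_comm] at h2
    subst h2
    exact Matsumoto.class_mixγ s₁ a b c d e f hs₁ (hnc hne) hPL hA11 hA12 hD22 hT1 hT2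

end Summit.SmoothPoincare4.SmoothPoincare4.Theorems.AcyclicBisectionRigidity.FoldedCurveBranchLocus
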